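import Summits.CriticalPhenomena.Ising3DConformalLimit.Theorems.PrecisionLaplacianDirectCorrelationStableTailSlabModeExpDecayDiagLineHolAux4
import Summits.CriticalPhenomena.Ising3DConformalLimit.Theorems.PrecisionLaplacianDirectCorrelationStableTailSlabModeExpDecayDiagLineHolAux2

/-!
# Diagonal line holomorphy, auxiliary file 5: localisation kernels at a good transverse momentum

Helper file for the sub-stub `stub_slabModeExpDecay_auxDiagLineHol` (brick of `stub_slabModeExpDecay`)
of line `self-energy-pick-inversion`, crux `PrecisionLaplacian.DirectCorrelationStableTail`
(stmt-CriticalPhenomena-4799). Pure theorem file.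

The test vectors of the localisation at a good transverse momentum `κ₀ ∈ (-π,π)² ∖ {0}` are the
centred binomial weights of file 2 with a quarter-phase, `f_N(y) = b_N(y) cos(κ₀·y - κ₀₀/4)` on
`{-N,…,N}²`. With the bump `Π_N(ξ) = ∏_j (2 + 2cos ξ_j)^N`:

* `testWeight_eq` : `∑ f_N(a) f_N(b) cos(k·(a-b)) = ¼ (Π_N(k+κ₀)² + Π_N(k-κ₀)²) + ½ cos(κ₀₀/2) Π_N(k+κ₀) Π_N(k-κ₀)`;
* `crossWeight_eq` : `∑ f_N(a) f_N(b) cos(k₀/2 - k·(a+b))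
    = ¼ (cos((k₀-κ₀₀)/2) Π_N(k-κ₀)² + cos((k₀+κ₀₀)/2) Π_N(k+κ₀)²) + ½ cos(k₀/2) Π_N(k+κ₀) Π_N(k-κ₀)`
  — the quarter-phase makes the coefficients of the squared bumps equal to `1` AT the bumps;
* `tendsto_bumpSq_localise`, `tendsto_overlap_integral` (registered sub-goal
  `stub_slabModeExpDecay_auxDiagLineHol6`): `∫ h Π_N(· - κ₁)² / (16^N I_{2N}²) → h(κ₁)` at a point of
  continuity `κ₁ ∈ (-π,π)²` of an integrable `h` (file `…PickInversionAux13`), while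
  `∫ h Π_N(· + κ₀) Π_N(· - κ₀) / (16^N I_{2N}²) → 0` when `|cos κ₀_{j₀}| < 1` (file 2);
* evenness and continuity in `k` of the diagonal line transforms `∫ cos(mθ) γ_k`, `∫ cos(2nθ) cos θ γ_k`.
-/

noncomputable section

namespace Summit.CriticalPhenomena.Ising3DConformalLimit.Cruxes.DirectCorrelationStableTail.SelfEnergyPickInversion

open MeasureTheory Filter Topology Finset Real Literature.Probability.LatticeModels
open scoped BigOperators
open Summit.CriticalPhenomena.Ising3DConformalLimit.Theorems.EtaBoundsTransfer
  (continuous_phase continuous_fourier_q abs_fourier_q_le_one integrableOn_cube_of_continuous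
    volume_cube_lt_top)

variable {q : Site 3 → ℝ} {P : ℕ → Site 3 → ℝ}

/-! ### Trigonometric expansions of the test weights -/

/-- `-k·w = -(k·w)`. [folklore] -/
theorem phase_neg_left {d : ℕ} (k : Fin d → ℝ) (w : Fin d → ℤ) : phase d (-k) w = -phase d k w := by
  have h := phase_sub_left (0 : Fin d → ℝ) k w
  rwa [zero_sub, show phase d (0 : Fin d → ℝ) w = 0 by simp [phase], zero_sub] at h

/-- A triple product of cosines, first form. [folklore] -/
theorem cos_sub_mul_cos_sub_mul_cos_sub (A B Ka Kb φ : ℝ) :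
    Real.cos (A - φ) * Real.cos (B - φ) * Real.cos (Ka - Kb) =
      (1 / 4) * (Real.cos ((A + Ka) + (-B - Kb) + 0) + Real.cos ((A - Ka) + (-B + Kb) + 0) +
        Real.cos ((A + Ka) + (B - Kb) + -(2 * φ)) + Real.cos ((A - Ka) + (B + Kb) + -(2 * φ))) := by
  have hcc : ∀ x y : ℝ, Real.cos x * Real.cos y = (Real.cos (x + y) + Real.cos (x - y)) / 2 := fun x y => by
    rw [Real.cos_add, Real.cos_sub]; ring
  have h1 := hcc (A - φ) (B - φ)
  have h2 := hcc ((A - φ) + (B - φ)) (Ka - Kb)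
  have h3 := hcc ((A - φ) - (B - φ)) (Ka - Kb)
  have e1 : Real.cos ((A - φ) + (B - φ) + (Ka - Kb)) = Real.cos ((A + Ka) + (B - Kb) + -(2 * φ)) := by
    congr 1; ring
  have e2 : Real.cos ((A - φ) + (B - φ) - (Ka - Kb)) = Real.cos ((A - Ka) + (B + Kb) + -(2 * φ)) := by
    congr 1; ring
  have e3 : Real.cos ((A - φ) - (B - φ) + (Ka - Kb)) = Real.cos ((A + Ka) + (-B - Kb) + 0) := by
    congr 1; ring
  have e4 : Real.cos ((A - φ) - (B - φ) - (Ka - Kb)) = Real.cos ((A - Ka) + (-B + Kb) + 0) := by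
    congr 1; ring
  linear_combination (Real.cos (Ka - Kb)) * h1 + (1 / 2) * h2 + (1 / 2) * h3 + (1 / 4) * (e1 + e2 + e3 + e4)

/-- A triple product of cosines, second form. [folklore] -/
theorem cos_sub_mul_cos_sub_mul_cos_sub' (A B Ka Kb φ c : ℝ) :
    Real.cos (A - φ) * Real.cos (B - φ) * Real.cos (c - (Ka + Kb)) =
      (1 / 4) * (Real.cos ((A - Ka) + (-B - Kb) + c) + Real.cos ((A + Ka) + (-B + Kb) + -c) +
        Real.cos ((A - Ka) + (B - Kb) + (c - 2 * φ)) + Real.cos ((A + Ka) + (B + Kb) + (-c - 2 * φ))) := by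
  have hcc : ∀ x y : ℝ, Real.cos x * Real.cos y = (Real.cos (x + y) + Real.cos (x - y)) / 2 := fun x y => by
    rw [Real.cos_add, Real.cos_sub]; ring
  have h1 := hcc (A - φ) (B - φ)
  have h2 := hcc ((A - φ) + (B - φ)) (c - (Ka + Kb))
  have h3 := hcc ((A - φ) - (B - φ)) (c - (Ka + Kb))
  have e1 : Real.cos ((A - φ) + (B - φ) + (c - (Ka + Kb))) = Real.cos ((A - Ka) + (B - Kb) + (c - 2 * φ)) := by
    congr 1; ring
  have e2 : Real.cos ((A - φ) + (B - φ) - (c - (Ka + Kb))) = Real.cos ((A + Ka) + (B + Kb) + (-c - 2 * φ)) := by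
    congr 1; ring
  have e3 : Real.cos ((A - φ) - (B - φ) + (c - (Ka + Kb))) = Real.cos ((A - Ka) + (-B - Kb) + c) := by
    congr 1; ring
  have e4 : Real.cos ((A - φ) - (B - φ) - (c - (Ka + Kb))) = Real.cos ((A + Ka) + (-B + Kb) + -c) := by
    congr 1; ring
  linear_combination (Real.cos (c - (Ka + Kb))) * h1 + (1 / 2) * h2 + (1 / 2) * h3 + (1 / 4) * (e1 + e2 + e3 + e4)

/-- The bump is even: `Π_N(-ξ) = Π_N(ξ)`. [folklore] -/
theorem bump_neg (N : ℕ) (ξ : Fin 2 → ℝ) :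
    ∏ j, (2 + 2 * Real.cos ((-ξ) j)) ^ N = ∏ j, (2 + 2 * Real.cos (ξ j)) ^ N := by
  simp only [Pi.neg_apply, Real.cos_neg]

/-- **The even test weight**: for `f_N(y) = b_N(y) cos(κ₀·y - κ₀₀/4)`,
`∑_{a,b} f_N(a) f_N(b) cos(k·(a - b)) = ¼ (Π_N(k+κ₀)² + Π_N(k-κ₀)²) + ½ cos(κ₀₀/2) Π_N(k+κ₀) Π_N(k-κ₀)`.
[folklore] -/
theorem testWeight_eq (N : ℕ) (κ₀ k : Fin 2 → ℝ) :
    ∑ a ∈ Fintype.piFinset (fun _ : Fin 2 => Finset.Icc (-(N : ℤ)) N),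
      ∑ b ∈ Fintype.piFinset (fun _ : Fin 2 => Finset.Icc (-(N : ℤ)) N),
        ((∏ j, ((2 * N).choose (a j + N).toNat : ℝ)) * Real.cos (phase 2 κ₀ a - κ₀ 0 / 4)) *
        ((∏ j, ((2 * N).choose (b j + N).toNat : ℝ)) * Real.cos (phase 2 κ₀ b - κ₀ 0 / 4)) *
          Real.cos (phase 2 k (a - b)) =
      (1 / 4) * ((∏ j, (2 + 2 * Real.cos ((k + κ₀) j)) ^ N) ^ 2 + (∏ j, (2 + 2 * Real.cos ((k - κ₀) j)) ^ N) ^ 2) +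
      (1 / 2) * Real.cos (κ₀ 0 / 2) *
        ((∏ j, (2 + 2 * Real.cos ((k + κ₀) j)) ^ N) * ∏ j, (2 + 2 * Real.cos ((k - κ₀) j)) ^ N) := by
  have hterm : ∀ a b : Fin 2 → ℤ,
      ((∏ j, ((2 * N).choose (a j + N).toNat : ℝ)) * Real.cos (phase 2 κ₀ a - κ₀ 0 / 4)) * ((∏ j, ((2 * N).choose (b j + N).toNat : ℝ)) * Real.cos (phase 2 κ₀ b - κ₀ 0 / 4)) *
        Real.cos (phase 2 k (a - b)) =
      (1 / 4) * ((∏ j, ((2 * N).choose (a j + N).toNat : ℝ)) * (∏ j, ((2 * N).choose (b j + N).toNat : ℝ)) * Real.cos (phase 2 (κ₀ + k) a + phase 2 (-κ₀ - k) b + 0)) +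
      (1 / 4) * ((∏ j, ((2 * N).choose (a j + N).toNat : ℝ)) * (∏ j, ((2 * N).choose (b j + N).toNat : ℝ)) * Real.cos (phase 2 (κ₀ - k) a + phase 2 (-κ₀ + k) b + 0)) +
      (1 / 4) * ((∏ j, ((2 * N).choose (a j + N).toNat : ℝ)) * (∏ j, ((2 * N).choose (b j + N).toNat : ℝ)) * Real.cos (phase 2 (κ₀ + k) a + phase 2 (κ₀ - k) b + -(2 * (κ₀ 0 / 4)))) +
      (1 / 4) * ((∏ j, ((2 * N).choose (a j + N).toNat : ℝ)) * (∏ j, ((2 * N).choose (b j + N).toNat : ℝ)) * Real.cos (phase 2 (κ₀ - k) a + phase 2 (κ₀ + k) b + -(2 * (κ₀ 0 / 4)))) := by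
    intro a b
    simp only [phase_sub, phase_add_left, phase_sub_left, phase_neg_left]
    linear_combination ((∏ j, ((2 * N).choose (a j + N).toNat : ℝ)) * (∏ j, ((2 * N).choose (b j + N).toNat : ℝ))) *
      cos_sub_mul_cos_sub_mul_cos_sub (phase 2 κ₀ a) (phase 2 κ₀ b) (phase 2 k a) (phase 2 k b) (κ₀ 0 / 4)
  simp_rw [hterm, Finset.sum_add_distrib, ← Finset.mul_sum, centredBinomial_sum_sum_cos]
  rw [show -κ₀ - k = -(k + κ₀) by ring, show κ₀ + k = k + κ₀ by ring, show -κ₀ + k = k - κ₀ by ring,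
    show κ₀ - k = -(k - κ₀) by ring, bump_neg, bump_neg, Real.cos_zero,
    show -(2 * (κ₀ 0 / 4)) = -(κ₀ 0 / 2) by ring, Real.cos_neg]
  ring

/-- **The cross test weight** (the quarter-phase at work):
`∑_{a,b} f_N(a) f_N(b) cos(k₀/2 - k·(a + b))
  = ¼ (cos((k₀-κ₀₀)/2) Π_N(k-κ₀)² + cos((k₀+κ₀₀)/2) Π_N(k+κ₀)²) + ½ cos(k₀/2) Π_N(k+κ₀) Π_N(k-κ₀)`. [folklore] -/
theorem crossWeight_eq (N : ℕ) (κ₀ k : Fin 2 → ℝ) :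
    ∑ a ∈ Fintype.piFinset (fun _ : Fin 2 => Finset.Icc (-(N : ℤ)) N),
      ∑ b ∈ Fintype.piFinset (fun _ : Fin 2 => Finset.Icc (-(N : ℤ)) N),
        ((∏ j, ((2 * N).choose (a j + N).toNat : ℝ)) * Real.cos (phase 2 κ₀ a - κ₀ 0 / 4)) *
        ((∏ j, ((2 * N).choose (b j + N).toNat : ℝ)) * Real.cos (phase 2 κ₀ b - κ₀ 0 / 4)) *
          Real.cos (k 0 / 2 - phase 2 k (a + b)) =
      (1 / 4) * (Real.cos ((k 0 - κ₀ 0) / 2) * (∏ j, (2 + 2 * Real.cos ((k - κ₀) j)) ^ N) ^ 2 +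
        Real.cos ((k 0 + κ₀ 0) / 2) * (∏ j, (2 + 2 * Real.cos ((k + κ₀) j)) ^ N) ^ 2) +
      (1 / 2) * Real.cos (k 0 / 2) *
        ((∏ j, (2 + 2 * Real.cos ((k + κ₀) j)) ^ N) * ∏ j, (2 + 2 * Real.cos ((k - κ₀) j)) ^ N) := by
  have hterm : ∀ a b : Fin 2 → ℤ,
      ((∏ j, ((2 * N).choose (a j + N).toNat : ℝ)) * Real.cos (phase 2 κ₀ a - κ₀ 0 / 4)) * ((∏ j, ((2 * N).choose (b j + N).toNat : ℝ)) * Real.cos (phase 2 κ₀ b - κ₀ 0 / 4)) *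
        Real.cos (k 0 / 2 - phase 2 k (a + b)) =
      (1 / 4) * ((∏ j, ((2 * N).choose (a j + N).toNat : ℝ)) * (∏ j, ((2 * N).choose (b j + N).toNat : ℝ)) * Real.cos (phase 2 (κ₀ - k) a + phase 2 (-κ₀ - k) b + k 0 / 2)) +
      (1 / 4) * ((∏ j, ((2 * N).choose (a j + N).toNat : ℝ)) * (∏ j, ((2 * N).choose (b j + N).toNat : ℝ)) * Real.cos (phase 2 (κ₀ + k) a + phase 2 (-κ₀ + k) b + -(k 0 / 2))) +
      (1 / 4) * ((∏ j, ((2 * N).choose (a j + N).toNat : ℝ)) * (∏ j, ((2 * N).choose (b j + N).toNat : ℝ)) * Real.cos (phase 2 (κ₀ - k) a + phase 2 (κ₀ - k) b + (k 0 / 2 - 2 * (κ₀ 0 / 4)))) +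
      (1 / 4) * ((∏ j, ((2 * N).choose (a j + N).toNat : ℝ)) * (∏ j, ((2 * N).choose (b j + N).toNat : ℝ)) * Real.cos (phase 2 (κ₀ + k) a + phase 2 (κ₀ + k) b + (-(k 0 / 2) - 2 * (κ₀ 0 / 4)))) := by
    intro a b
    simp only [phase_add, phase_add_left, phase_sub_left, phase_neg_left]
    linear_combination ((∏ j, ((2 * N).choose (a j + N).toNat : ℝ)) * (∏ j, ((2 * N).choose (b j + N).toNat : ℝ))) *
      cos_sub_mul_cos_sub_mul_cos_sub' (phase 2 κ₀ a) (phase 2 κ₀ b) (phase 2 k a) (phase 2 k b) (κ₀ 0 / 4) (k 0 / 2)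
  simp_rw [hterm, Finset.sum_add_distrib, ← Finset.mul_sum, centredBinomial_sum_sum_cos]
  rw [show -κ₀ - k = -(k + κ₀) by ring, show κ₀ + k = k + κ₀ by ring, show -κ₀ + k = k - κ₀ by ring,
    show κ₀ - k = -(k - κ₀) by ring, bump_neg, bump_neg, Real.cos_neg,
    show k 0 / 2 - 2 * (κ₀ 0 / 4) = (k 0 - κ₀ 0) / 2 by ring,
    show -(k 0 / 2) - 2 * (κ₀ 0 / 4) = -((k 0 + κ₀ 0) / 2) by ring, Real.cos_neg]
  ring

/-! ### Localisation and overlap limits -/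

/-- The squared bump is the de la Vallée-Poussin kernel with parameter `2N`:
`Π_N(k - κ₁)² = 16^N ∏_j (1 + cos(k_j - κ₁ⱼ))^{2N}`. [folklore] -/
theorem bump_sq_eq (N : ℕ) (k κ₁ : Fin 2 → ℝ) :
    (∏ j, (2 + 2 * Real.cos ((k - κ₁) j)) ^ N) ^ 2 = 16 ^ N * ∏ j, (1 + Real.cos (k j - κ₁ j)) ^ (2 * N) := by
  have : ∀ j, (2 + 2 * Real.cos ((k - κ₁) j)) ^ N = 2 ^ N * (1 + Real.cos (k j - κ₁ j)) ^ N := fun j => by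
    rw [← mul_pow, Pi.sub_apply]; ring
  simp_rw [this]
  rw [Finset.prod_mul_distrib, Fin.prod_const, mul_pow, ← Finset.prod_pow]
  simp_rw [← pow_mul, show N * 2 = 2 * N from mul_comm _ _]
  congr 1
  rw [show 2 * N * 2 = 4 * N by ring, pow_mul]
  norm_num

/-- **Localisation with the squared bump**: at a point of continuity `κ₁ ∈ (-π,π)²` of an `h`
integrable over `[-π,π]²`, `∫ h(k) Π_N(k - κ₁)² dk / (16^N I_{2N}²) → h(κ₁)`. [folklore] -/
theorem tendsto_bumpSq_localise {h : (Fin 2 → ℝ) → ℝ}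
    (hint : IntegrableOn h (Set.pi Set.univ (fun _ : Fin 2 => Set.Icc (-π) π)) volume)
    {κ₁ : Fin 2 → ℝ} (hκ₁ : ∀ j, |κ₁ j| < π) (hcont : ContinuousAt h κ₁) :
    Tendsto (fun N : ℕ => (∫ k in Set.pi Set.univ (fun _ : Fin 2 => Set.Icc (-π) π),
        h k * (∏ j, (2 + 2 * Real.cos ((k - κ₁) j)) ^ N) ^ 2) /
        (16 ^ N * (∫ t in (-π)..π, (1 + Real.cos t) ^ (2 * N)) ^ 2)) atTop (𝓝 (h κ₁)) := by
  have h1 := (tendsto_setIntegral_vp_kernel hint hκ₁ hcont).comp (tendsto_id.const_mul_atTop' two_pos)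
  refine h1.congr fun N => ?_
  simp only [Function.comp_apply, id]
  simp_rw [bump_sq_eq, ← mul_assoc, mul_comm (h _) ((16 : ℝ) ^ N), mul_assoc]
  rw [integral_const_mul, mul_div_mul_left _ _ (by positivity)]

/-- **The overlap of the two bumps is negligible**: for `h` integrable over `[-π,π]²` and a momentum
`κ₀` with `|cos κ₀_{j₀}| < 1`, `∫ h(k) Π_N(k + κ₀) Π_N(k - κ₀) dk / (16^N I_{2N}²) → 0`. [folklore] -/
theorem tendsto_overlap_integral {h : (Fin 2 → ℝ) → ℝ}
    (hint : IntegrableOn h (Set.pi Set.univ (fun _ : Fin 2 => Set.Icc (-π) π)) volume)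
    {κ₀ : Fin 2 → ℝ} {j₀ : Fin 2} (hj₀ : |Real.cos (κ₀ j₀)| < 1) :
    Tendsto (fun N : ℕ => (∫ k in Set.pi Set.univ (fun _ : Fin 2 => Set.Icc (-π) π),
        h k * ((∏ j, (2 + 2 * Real.cos ((k + κ₀) j)) ^ N) * ∏ j, (2 + 2 * Real.cos ((k - κ₀) j)) ^ N)) /
        (16 ^ N * (∫ t in (-π)..π, (1 + Real.cos t) ^ (2 * N)) ^ 2)) atTop (𝓝 0) := by
  set c : ℝ := |Real.cos (κ₀ j₀)| with hc
  have hc0 : 0 ≤ c := abs_nonneg _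
  set L : ℝ := ∫ k in Set.pi Set.univ (fun _ : Fin 2 => Set.Icc (-π) π), |h k| with hL
  have hL0 : 0 ≤ L := integral_nonneg fun k => abs_nonneg _
  have hratio := (tendsto_overlap_ratio hc0 hj₀).const_mul L
  rw [mul_zero] at hratio
  rw [tendsto_zero_iff_abs_tendsto_zero]
  refine tendsto_of_tendsto_of_tendsto_of_le_of_le' tendsto_const_nhds hratio
    (Eventually.of_forall fun N => abs_nonneg _) (Eventually.of_forall fun N => ?_)
  simp only [Function.comp_apply]
  have hI : 0 < ∫ t in (-π)..π, (1 + Real.cos t) ^ (2 * N) := vp_integral_pos (2 * N)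
  have hden : 0 < (16 : ℝ) ^ N * (∫ t in (-π)..π, (1 + Real.cos t) ^ (2 * N)) ^ 2 := by positivity
  rw [abs_div, abs_of_pos hden, div_le_iff₀ hden]
  have hpt : ∀ k, |h k * ((∏ j, (2 + 2 * Real.cos ((k + κ₀) j)) ^ N) * ∏ j, (2 + 2 * Real.cos ((k - κ₀) j)) ^ N)| ≤
      |h k| * (16 ^ N * 4 ^ N * (1 + c) ^ (2 * N)) := by
    intro k
    rw [abs_mul]
    refine mul_le_mul_of_nonneg_left ?_ (abs_nonneg _)
    rw [abs_of_nonneg (mul_nonneg (Finset.prod_nonneg fun j _ => pow_nonneg (by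
      linarith [Real.neg_one_le_cos ((k + κ₀) j)]) N) (Finset.prod_nonneg fun j _ => pow_nonneg (by
      linarith [Real.neg_one_le_cos ((k - κ₀) j)]) N))]
    exact prod_bump_add_mul_prod_bump_sub_le N hc0 le_rfl k
  calc |∫ k in Set.pi Set.univ (fun _ : Fin 2 => Set.Icc (-π) π),
        h k * ((∏ j, (2 + 2 * Real.cos ((k + κ₀) j)) ^ N) * ∏ j, (2 + 2 * Real.cos ((k - κ₀) j)) ^ N)|
      ≤ ∫ k in Set.pi Set.univ (fun _ : Fin 2 => Set.Icc (-π) π),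
          |h k * ((∏ j, (2 + 2 * Real.cos ((k + κ₀) j)) ^ N) * ∏ j, (2 + 2 * Real.cos ((k - κ₀) j)) ^ N)| :=
        abs_integral_le_integral_abs
    _ ≤ ∫ k in Set.pi Set.univ (fun _ : Fin 2 => Set.Icc (-π) π), |h k| * (16 ^ N * 4 ^ N * (1 + c) ^ (2 * N)) := by
        refine integral_mono_of_nonneg (Eventually.of_forall fun k => abs_nonneg _)
          (hint.abs.mul_const _) (Eventually.of_forall hpt)
    _ = L * (16 ^ N * 4 ^ N * (1 + c) ^ (2 * N)) := by rw [integral_mul_const]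
    _ = L * ((1 + c) ^ (2 * N) * 2 ^ (2 * N) / (∫ t in (-π)..π, (1 + Real.cos t) ^ (2 * N)) ^ 2) *
          (16 ^ N * (∫ t in (-π)..π, (1 + Real.cos t) ^ (2 * N)) ^ 2) := by
        rw [show (2 : ℝ) ^ (2 * N) = 4 ^ N by rw [pow_mul]; norm_num]
        field_simp

/-- **Registered auxiliary stub `stub_slabModeExpDecay_auxDiagLineHol6`** (sub-goal of the brick
`stub_slabModeExpDecay_auxDiagLineHol` of `stub_slabModeExpDecay`): the overlap of the two bumps
centred at `±κ₀` is negligible (`tendsto_overlap_integral`). [folklore] -/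
theorem stub_slabModeExpDecay_auxDiagLineHol6 : ∀ (h : (Fin 2 → ℝ) → ℝ) (κ₀ : Fin 2 → ℝ) (j₀ : Fin 2), MeasureTheory.IntegrableOn h (Set.pi Set.univ (fun _ : Fin 2 => Set.Icc (-Real.pi) Real.pi)) → |Real.cos (κ₀ j₀)| < 1 → Filter.Tendsto (fun N : ℕ => (∫ k in Set.pi Set.univ (fun _ : Fin 2 => Set.Icc (-Real.pi) Real.pi), h k * ((∏ j, (2 + 2 * Real.cos ((k + κ₀) j)) ^ N) * ∏ j, (2 + 2 * Real.cos ((k - κ₀) j)) ^ N)) / (16 ^ N * (∫ t in (-Real.pi)..Real.pi, (1 + Real.cos t) ^ (2 * N)) ^ 2)) Filter.atTop (nhds 0) :=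
  fun _ _ _ hint hj₀ => tendsto_overlap_integral hint hj₀

/-! ### Evenness and continuity of the diagonal line transforms in the transverse momentum -/

/-- A reduced nonzero transverse momentum is good: `κ₀ ∈ (-π,π)² ∖ {0}` is off `(2πℤ)²`, and so is
`-κ₀`; moreover `|cos κ₀_{j₀}| < 1` at a nonzero coordinate. [folklore] -/
theorem good_of_reduced {κ₀ : Fin 2 → ℝ} (hκ₀ : ∀ j, |κ₀ j| < π) {j₀ : Fin 2} (hj₀ : κ₀ j₀ ≠ 0) :
    (∀ z : ℤ, κ₀ j₀ ≠ z * (2 * π)) ∧ (∀ z : ℤ, (-κ₀) j₀ ≠ z * (2 * π)) ∧ |Real.cos (κ₀ j₀)| < 1 := by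
  have hπ := Real.pi_pos
  have key : ∀ a : ℝ, |a| < π → a ≠ 0 → ∀ z : ℤ, a ≠ z * (2 * π) := by
    intro a ha ha0 z hz
    have h1 : |(z : ℝ)| * (2 * π) < π := by rw [hz, abs_mul, abs_of_pos Real.two_pi_pos] at ha; exact ha
    have h2 : |(z : ℝ)| < 1 := by nlinarith [abs_nonneg (z : ℝ)]
    have h3 : z = 0 := by
      have : |z| < 1 := by exact_mod_cast h2
      exact Int.abs_lt_one_iff.mp this
    subst h3
    exact ha0 (by simpa using hz)
  refine ⟨key _ (hκ₀ j₀) hj₀, key _ (by simpa using hκ₀ j₀) (by simpa using hj₀), ?_⟩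
  rw [abs_lt]
  have hlt : |κ₀ j₀| < π := hκ₀ j₀
  have hcos : Real.cos (κ₀ j₀) < 1 := by
    rw [← Real.cos_abs]
    have := Real.cos_lt_cos_of_nonneg_of_le_pi le_rfl hlt.le (abs_pos.2 hj₀)
    rwa [Real.cos_zero] at this
  have hcos' : -1 < Real.cos (κ₀ j₀) := by
    rw [← Real.cos_abs, ← Real.cos_pi]
    exact Real.cos_lt_cos_of_nonneg_of_le_pi (abs_nonneg _) le_rfl hlt
  exact ⟨hcos', hcos⟩

/-- **Evenness of the line transforms in the transverse momentum** (`q` invariant under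
`x ↦ (x₁, x₀, -x₂)`). [folklore] -/
theorem lineTransform_neg_momentum (hqsym : ∀ x : Site 3, q ![x 1, x 0, -(x 2)] = q x) (w : ℝ → ℝ)
    (k : Fin 2 → ℝ) :
    ∫ θ in (-π)..π, w θ * (1 - ∑' x : Site 3, q x * Real.cos (phase 3 ![θ + (-k) 0 / 2, θ - (-k) 0 / 2, (-k) 1] x))⁻¹ =
      ∫ θ in (-π)..π, w θ * (1 - ∑' x : Site 3, q x * Real.cos (phase 3 ![θ + k 0 / 2, θ - k 0 / 2, k 1] x))⁻¹ := by
  refine intervalIntegral.integral_congr fun θ _ => ?_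
  simp only [lineFun_neg_momentum hqsym k θ]

/-- **The odd weight as two cosine transforms**: `cos(2nθ) cos θ = (cos((2n+1)θ) + cos(|2n-1| θ))/2`,
hence `∫ cos(2nθ) cos θ γ = (∫ cos((2n+1)θ) γ + ∫ cos(|2n-1|θ) γ)/2` for any `γ`. [folklore] -/
theorem integral_cos_two_mul_cos_eq (γ : ℝ → ℝ) (n : ℕ) :
    ∫ θ in (-π)..π, Real.cos (2 * n * θ) * Real.cos θ * γ θ =
      (1 / 2) * ∫ θ in (-π)..π, (Real.cos (((2 * n + 1 : ℕ) : ℝ) * θ) +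
        Real.cos (((Int.natAbs (2 * n - 1 : ℤ) : ℕ) : ℝ) * θ)) * γ θ := by
  rw [← intervalIntegral.integral_const_mul]
  refine intervalIntegral.integral_congr fun θ _ => ?_
  have habs : Real.cos (((Int.natAbs (2 * n - 1 : ℤ) : ℕ) : ℝ) * θ) = Real.cos ((2 * n - 1) * θ) := by
    rw [Nat.cast_natAbs, Int.cast_abs, ← Real.cos_abs ((2 * n - 1) * θ), ← Real.cos_abs (_ * θ), abs_mul, abs_mul,
      abs_abs]
    push_cast; ring_nf
  simp only [habs]
  push_cast
  rw [show (2 * (n : ℝ) + 1) * θ = 2 * n * θ + θ by ring, show (2 * (n : ℝ) - 1) * θ = 2 * n * θ - θ by ring,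
    Real.cos_add, Real.cos_sub]
  ring

/-! ### Small tools -/

/-- Moments of a finite measure on `[-1, 1]`: `x ↦ x^m` is integrable, and the even moments are at
most the mass. [folklore] -/
theorem integrable_pow_of_Icc_neg_one {ν : Measure ℝ} [IsFiniteMeasure ν] (hν : ν (Set.Icc (-1 : ℝ) 1)ᶜ = 0)
    (m : ℕ) : Integrable (fun x : ℝ => x ^ m) ν ∧ ∫ x, x ^ (2 * m) ∂ν ≤ ∫ x, x ^ 0 ∂ν := by
  have hae : ∀ᵐ x ∂ν, x ∈ Set.Icc (-1 : ℝ) 1 := by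
    rw [ae_iff]; simpa only [Set.mem_setOf_eq, ← Set.mem_compl_iff, Set.setOf_mem_eq] using hν
  have hint : ∀ m : ℕ, Integrable (fun x : ℝ => x ^ m) ν := fun m =>
    Integrable.mono' (integrable_const 1) (Measurable.aestronglyMeasurable (by fun_prop))
      (hae.mono fun x hx => by
        rw [Real.norm_eq_abs, abs_pow]; exact pow_le_one₀ (abs_nonneg x) (abs_le.2 ⟨hx.1, hx.2⟩))
  refine ⟨hint m, integral_mono_ae (hint (2 * m)) (hint 0) (hae.mono fun x hx => ?_)⟩
  show x ^ (2 * m) ≤ x ^ 0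
  rw [pow_zero, pow_mul, ← sq_abs]
  exact pow_le_one₀ (sq_nonneg _) (by nlinarith [abs_nonneg x, abs_le.2 ⟨hx.1, hx.2⟩])

/-- Goodness is an open condition: if `κ₀ ∉ (2πℤ)²` then nearby momenta are off `(2πℤ)²`. [folklore] -/
theorem eventually_good {κ₀ : Fin 2 → ℝ} (hk₀ : ∃ j, ∀ z : ℤ, κ₀ j ≠ z * (2 * π)) :
    ∀ᶠ k in 𝓝 κ₀, ∃ j, ∀ z : ℤ, (k : Fin 2 → ℝ) j ≠ z * (2 * π) := by
  obtain ⟨j, hj⟩ := hk₀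
  obtain ⟨m₀, hm₀, hmarg⟩ := exists_margin_of_forall_ne hj
  filter_upwards [Metric.ball_mem_nhds κ₀ (half_pos hm₀)] with k hk
  refine ⟨j, fun z hz => ?_⟩
  have hd : |k j - κ₀ j| < m₀ / 2 := by
    have := dist_le_pi_dist k κ₀ j; rw [Real.dist_eq] at this; exact lt_of_le_of_lt this hk
  have := hmarg z
  rw [← hz, abs_sub_comm] at this
  linarith


end Summit.CriticalPhenomena.Ising3DConformalLimit.Cruxes.DirectCorrelationStableTail.SelfEnergyPickInversion

end
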